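/- Copyright: the b2b-balaban cell (near-miss cell 7), T⁴-continuum fan-out, lineage t4-ne7b-p1 (node U5c COUNT
member).  Released under the licence of the surrounding project. -/
import Summits.QuantumFields.BalabanUV.T4Continuum.Support.HistoryBankingVolumeProfile
import Summits.QuantumFields.BalabanUV.T4Continuum.Support.HistoryRealise
import Literature.MathematicalPhysics.QuantumFieldTheory.Balaban1983to89.B16Overhang

/-!
# M5-1b (A3c, first brick) — THE YOUNG PHASE OF ONE BIRTH IS INSIDE ITS OWN WINDOW, AND ITS VOLUME COST IS BOOKED
(owner module of row NE7b, lineage `t4-ne7b-p1` gen 43; re-open object (α), `SCOPE-alpha.md` v2.6, ruling R-OWNER-43-1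
«THE FLAT ANCHOR LEDGER» (e), YOUNG term; PRE-POSITIONING ONLY)

Summits-side support leaf of the T⁴-continuum cell (rung (B)+1 on a FINITE torus only; NOT infinite volume, NOT the
mass gap, NOT the Clay statement; NOT a proof of the spine estimate NE7b, which is the cell's OWN estimate, NOT PRINTED
and NOT PROVED).  [folklore] finite sums and real arithmetic over the lineage's orbit vocabulary
(`HistoryRealise.orbit`, `dropCtl_from`), M5-1a `HistoryBankingVolumeProfile` (`unitCost_card_Siter_le_booked`,
`card_le_classLinear` — the per-region atom against the booked tables `T4PrintedShapeBanking.{wfloor, sz}` with the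
dictionary's `dictW`∕`fatWait`) and the b02 lineage's `B16Overhang.two_pow_le_of_not_condI` (a failure of condition
(i) at index `i` forces `2^i ≤ 2·treeLen Z`); nothing printed is asserted, no `def`, no cite-tagged hypothesis, zero
`sorry`.  B16 = [Balaban1989LargeFieldII] pp. 384–385 under audit; locators only.

WHY (ruling R-OWNER-43-1 (e), journal «RULING R-OWNER-43-1»).  In the flat anchor ledger the volume of a live structure
at step `m` splits into the images of its YOUNG births — those whose own orbit has not yet met condition (i) — and
`561^d` per dead anchor (A1 ∕ A3b).  The young images are paid birth by birth: THIS FILE shows (§1) that a birth region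
`Z` of recorded class `cls ≥ treeLen Z` whose orbit has NOT met condition (i) at the relative index `i ≥ 1` has
`i ≤ ⌊log₂ cls⌋ + 1 < dictW R n₁ (j, 0, cls) = fatWait cls + R_j + 1` (b02's `two_pow_le_of_not_condI`; sizes `R ≥ 1`)
— the young phase lies INSIDE THE BIRTH'S OWN BOOKED WINDOW —, hence (§2) by M5-1a every young step's weighted volume is
below the birth event's booked window floor plus size cost at that step (`young_step_le_booked`), and (§3) summed over the
performed steps `m ≤ K`, the birth's YOUNG VOLUME COST (the birth case of A3b's `youngVol`, written out) is at most the
class-linear birth-level term `u_j·2^d·4·(cls + 1)` (to the credit-slack factor, `HistoryConstantsTH …_of_slack`) plus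
the birth event's total performed bookings `Σ_{n ≤ K} (wfloor C K R j (j,0,cls) n + sz C K R (j,0,cls) n)`
(`sum_young_le_booked`).  The reading displays are M5-1a's: `u_n·5·126^d ≤ E₂R_n^{q′}`, `u_n·8·126^d ≤ E₃R_n^{q′}`.

WHAT IS *NOT* DONE HERE.  The other two terms of the ledger against the bookings (FLOOR: one performed window floor per
component-step via `T4PersistenceDictionary.Gen.covers` on the component's sub-genealogy; FEE: `j·561^d·L_u·u_{j_b}` per
birth on its window floors — both need the bridge `HistoryGenBridge.toPGen` ∕ `Pedigree.genT` between the geometric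
pedigree and the tagged genealogy `q.2` of the END), and the assembly with A2's `flat_total_le_births` into
`lifeCost (padW …) (κV K q) q.2 ≤ lifeCost (padW …) (costT …) q.2 + slack` (A3c, next owner gens).  HONEST: index-model
bookkeeping; NE7b NOT proved; spine 0∕9.  HONEST DEPENDENCY (cell): continuum YM on T⁴ ⇐ BetaPertH ∧ nine spine estimates
(0∕9 proved); BetaPertH ⇐ (D1) ∧ (D4) ∧ CAP+tail.  This file changes none of it.
-/

open Finset
open Literature.MathematicalPhysics.QuantumFieldTheory.Balaban1983to89
open Literature.MathematicalPhysics.QuantumFieldTheory.Balaban1983to89.B13ScaleTransfer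
open Literature.MathematicalPhysics.QuantumFieldTheory.Balaban1983to89.TreeLength
open Literature.MathematicalPhysics.QuantumFieldTheory.Balaban1983to89.B16SProfile
open Literature.MathematicalPhysics.QuantumFieldTheory.Balaban1983to89.B16StoppingRule
open Literature.MathematicalPhysics.QuantumFieldTheory.Balaban1983to89.B16Overhang
open T4PersistenceDictionary T4PrintedShapeBanking
open Summit.QuantumFields.BalabanUV.T4Continuum.HistoryRealise
open Summit.QuantumFields.BalabanUV.T4Continuum.HistoryBankingVolumeProfile

namespace Summit.QuantumFields.BalabanUV.T4Continuum.HistoryBankingYoungBirth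

noncomputable section

open scoped Classical

variable {d : ℕ} {L : ℕ} {s : ℕ → ℕ}

/-! ## §1 The young phase of a birth lies inside its own booked window -/

/-- **A FAILURE OF CONDITION (i) BOUNDS THE INDEX BY THE CLASS**: along a flow with `L ≥ 4` and drop control on every
horizon, a non-empty face-connected region `Z` with `treeLen Z ≤ cls` whose orbit from `j` has NOT met condition (i) at
the relative index `i ≥ 1` has `i ≤ ⌊log₂ cls⌋ + 1` (b02: `2^i ≤ 2·treeLen Z`). [folklore] -/
theorem le_log_succ_of_not_condI (hL : 4 ≤ L) (hdrop : ∀ m, DropCtl s m) {Z : Finset (Pt d)} (hZ : Z.Nonempty)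
    (hZc : FaceConnected Z) {cls : ℕ} (hd : treeLen Z ≤ cls) {j i : ℕ} (hi1 : 1 ≤ i)
    (hI : ¬ CondI 100 (orbit L s j Z i)) : i ≤ Nat.log 2 cls + 1 := by
  have h2 := two_pow_le_of_not_condI hL (dropCtl_from hdrop j i) hZ hZc hi1 le_rfl hI
  -- `2^i ≤ 2·treeLen Z ≤ 2·cls`, so `2^(i-1) ≤ cls` and `i − 1 ≤ log₂ cls`
  have hcls : (2 : ℝ) ^ i ≤ 2 * (cls : ℝ) := h2.trans (by linarith)
  have h1 : 1 ≤ treeLen Z := by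
    have : (2 : ℝ) ≤ 2 ^ i := by
      calc (2 : ℝ) = 2 ^ 1 := by norm_num
        _ ≤ 2 ^ i := pow_le_pow_right₀ (by norm_num) hi1
    linarith
  have hcls1 : 1 ≤ cls := by
    have : (1 : ℝ) ≤ cls := h1.trans hd
    exact_mod_cast this
  have hnat : 2 ^ (i - 1) ≤ cls := by
    have h' : (2 : ℝ) ^ (i - 1) * 2 = 2 ^ i := by
      rw [← pow_succ, Nat.sub_add_cancel hi1]
    have h'' : (2 : ℝ) ^ (i - 1) ≤ cls := by nlinarith
    exact_mod_cast h''
  have hlog : i - 1 ≤ Nat.log 2 cls := Nat.le_log_of_pow_le (by norm_num) hnat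
  omega

/-- **THE YOUNG PHASE IS INSIDE THE BIRTH WINDOW**: under the same hypotheses and sizes `R ≥ 1`,
`i < dictW R n₁ (j, 0, cls) = fatWait cls + R_j + 1`. [folklore] -/
theorem lt_dictW_of_not_condI (hL : 4 ≤ L) (hdrop : ∀ m, DropCtl s m) {Z : Finset (Pt d)} (hZ : Z.Nonempty)
    (hZc : FaceConnected Z) {cls : ℕ} (hd : treeLen Z ≤ cls) {R : ℕ → ℕ} (hR : ∀ t, 1 ≤ R t) (n₁ : ℕ) {j i : ℕ}
    (hi1 : 1 ≤ i) (hI : ¬ CondI 100 (orbit L s j Z i)) : i < dictW R n₁ ((j, 0, cls) : PEv) := by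
  have h := le_log_succ_of_not_condI hL hdrop hZ hZc hd hi1 hI
  have hf : Nat.log 2 cls ≤ fatWait cls := le_max_right _ _
  have hRj := hR j
  rw [dictW_birth]
  omega

/-! ## §2 One young step against the birth event's bookings -/

section Booked

variable {C : T4PrintedShapeBanking.Consts} {K : ℕ} {R : ℕ → ℕ}

/-- **ONE YOUNG STEP IS BOOKED**: for a birth at `j` of a non-empty face-connected region `Z` with recorded class
`cls ≥ treeLen Z`, flow `L ≥ 4` with drop control on every horizon, sizes `R ≥ 1`, per-step unit costs `u ≥ 0`
displayed against the tables as in M5-1a, and a relative index `i ≥ 1` with `j + i ≤ K` at which the orbit has NOT met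
condition (i): `u (j+i)·#orbit_j(Z, i) ≤ wfloor C K R j (j,0,cls) (j+i) + sz C K R (j,0,cls) (j+i)`. [folklore] -/
theorem young_step_le_booked (hL : 4 ≤ L) (hdrop : ∀ m, DropCtl s m) {Z : Finset (Pt d)} (hZ : Z.Nonempty)
    (hZc : FaceConnected Z) {cls : ℕ} (hd : treeLen Z ≤ cls) (hR : ∀ t, 1 ≤ R t) (hE₃ : 0 ≤ C.E₃) {u : ℕ → ℝ}
    (hu : ∀ n, 0 ≤ u n) (huE₂ : ∀ n, n ≤ K → u n * (5 * 126 ^ d) ≤ C.E₂ * (R n : ℝ) ^ C.q')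
    (huE₃ : ∀ n, n ≤ K → u n * (8 * 126 ^ d) ≤ C.E₃ * (R n : ℝ) ^ C.q') {j i : ℕ} (hi1 : 1 ≤ i) (hK : j + i ≤ K)
    (hI : ¬ CondI 100 (orbit L s j Z i)) :
    u (j + i) * ((orbit L s j Z i).card : ℝ) ≤
      wfloor C K R j ((j, 0, cls) : PEv) (j + i) + sz C K R ((j, 0, cls) : PEv) (j + i) :=
  unitCost_card_Siter_le_booked hL (dropCtl_from hdrop j i) hZ hZc hd hE₃ hu huE₂ huE₃ hi1 le_rfl hK
    (lt_dictW_of_not_condI hL hdrop hZ hZc hd hR C.n₁ hi1 hI)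

/-! ## §3 The young volume cost of one birth, summed over the performed steps -/

/-- **THE YOUNG VOLUME COST OF ONE BIRTH IS BOOKED** (ruling R-OWNER-43-1 (e), YOUNG term): summed over the performed
steps `m ≤ K`, the weighted young volume of a birth at `j` — `u_m·#orbit_j(Z, m−j)` at the steps `m ≥ j` at which the
orbit has met condition (i) at NO index `≤ m − j`, `0` elsewhere (the birth case of A3b's `youngVol`) — is at most the
class-linear birth-level term `u_j·2^d·4·(cls+1)` plus the birth event's total performed bookings. [folklore] -/
theorem sum_young_le_booked (hL : 4 ≤ L) (hdrop : ∀ m, DropCtl s m) {Z : Finset (Pt d)} (hZ : Z.Nonempty)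
    (hZc : FaceConnected Z) {cls : ℕ} (hd : treeLen Z ≤ cls) (hR : ∀ t, 1 ≤ R t) (hE₂ : 0 ≤ C.E₂) (hE₃ : 0 ≤ C.E₃)
    {u : ℕ → ℝ} (hu : ∀ n, 0 ≤ u n) (huE₂ : ∀ n, n ≤ K → u n * (5 * 126 ^ d) ≤ C.E₂ * (R n : ℝ) ^ C.q')
    (huE₃ : ∀ n, n ≤ K → u n * (8 * 126 ^ d) ≤ C.E₃ * (R n : ℝ) ^ C.q') (j : ℕ) :
    ∑ m ∈ Finset.range (K + 1), u m *
        (if j ≤ m ∧ ∀ i, i ≤ m - j → ¬ CondI 100 (orbit L s j Z i) then ((orbit L s j Z (m - j)).card : ℝ) else 0) ≤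
      u j * (2 ^ d * 4 * ((cls : ℝ) + 1))
        + ∑ n ∈ Finset.range (K + 1), (wfloor C K R j ((j, 0, cls) : PEv) n + sz C K R ((j, 0, cls) : PEv) n) := by
  -- termwise: the birth level against the class-linear term, a later young step against its booking, else `0`
  have hterm : ∀ m ∈ Finset.range (K + 1), u m *
      (if j ≤ m ∧ ∀ i, i ≤ m - j → ¬ CondI 100 (orbit L s j Z i) then ((orbit L s j Z (m - j)).card : ℝ) else 0) ≤
        (if m = j then u j * (2 ^ d * 4 * ((cls : ℝ) + 1)) else 0)
          + (wfloor C K R j ((j, 0, cls) : PEv) m + sz C K R ((j, 0, cls) : PEv) m) := by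
    intro m hm
    rw [Finset.mem_range] at hm
    have hb0 : 0 ≤ wfloor C K R j ((j, 0, cls) : PEv) m + sz C K R ((j, 0, cls) : PEv) m :=
      add_nonneg (wfloor_nonneg hE₂ _ _ _) (sz_nonneg hE₃ _ _)
    by_cases hy : j ≤ m ∧ ∀ i, i ≤ m - j → ¬ CondI 100 (orbit L s j Z i)
    · rw [if_pos hy]
      obtain ⟨hjm, hyoung⟩ := hy
      by_cases hmj : m = j
      · -- the birth level: class-linear
        subst hmj
        rw [if_pos rfl, Nat.sub_self, orbit_zero]
        have h1 := mul_le_mul_of_nonneg_left (card_le_classLinear hZ hZc hd) (hu m)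
        linarith
      · -- a later young step
        rw [if_neg hmj, zero_add]
        obtain ⟨i, rfl⟩ : ∃ i, m = j + i := ⟨m - j, by omega⟩
        have hi1 : 1 ≤ i := by omega
        rw [Nat.add_sub_cancel_left]
        exact young_step_le_booked hL hdrop hZ hZc hd hR hE₃ hu huE₂ huE₃ hi1 (by omega)
          (hyoung i (by omega))
    · rw [if_neg hy, mul_zero]
      have : 0 ≤ (if m = j then u j * (2 ^ d * 4 * ((cls : ℝ) + 1)) else 0) := by
        split_ifs
        · exact mul_nonneg (hu j) (by positivity)
        · exact le_rfl
      linarith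
  refine (Finset.sum_le_sum hterm).trans ?_
  rw [Finset.sum_add_distrib]
  have hδ : (∑ m ∈ Finset.range (K + 1), if m = j then u j * (2 ^ d * 4 * ((cls : ℝ) + 1)) else 0) ≤
      u j * (2 ^ d * 4 * ((cls : ℝ) + 1)) := by
    rw [Finset.sum_ite_eq']
    split_ifs
    · exact le_rfl
    · exact mul_nonneg (hu j) (by positivity)
  linarith

end Booked

/-! ## §4 Sanity: the young phase bound is not vacuous -/

/-- For class `cls = 1` the bound of §1 reads `i ≤ 1`: a unit-class region can fail condition (i) only at the first
step after its birth (`⌊log₂ 1⌋ = 0`). [folklore] -/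
theorem sanity_log_one : Nat.log 2 1 + 1 = 1 := by simp

end

end Summit.QuantumFields.BalabanUV.T4Continuum.HistoryBankingYoungBirth
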